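import Summits.QuantumAdvantage.QuantumAdvantage.Theorems.CubicForrelationNearExactIsExactDerivDegree
import Summits.QuantumAdvantage.QuantumAdvantage.Theorems.CubicForrelationNearExactIsExactRankTwoCeilingA

/-!
# Crux `CubicForrelation.NearExactIsExact` (stmt-QuantumAdvantage-14043), line `direct-sum-amplification`, lead c6 cycle 2:
  stub `stub_quadBalancedStructure` — a balanced quadratic has a complementing linear structure

If `q` has degree `≤ 2` on `n` bits and `Σ_y (−1)^{q(y)} = 0`, then some non-zero `e` satisfies `q(y ⊕ e) = ¬q(y)`
for all `y`.  Used by the lead to normalise the BALANCED split case at `n = 10` (the derivative `δ = D_c g` becomes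
`y₉ ⊕ Q(w)`).  Proof: `(Σ_y (−1)^{q(y)})² = Σ_e Σ_y (−1)^{q(y)⊕q(y⊕e)}` (reindex `z = y ⊕ e`, `qb_sq_sum_signOf`); every
derivative `D_e q = q ⊕ q(· ⊕ e)` is affine (`stub_derivDegree`, landed), and an affine function is either constant or
balanced (`qb_affine_dichotomy`: it is additive up to its value at `0` (`ar_affine_apply_bxor`, landed), so a
non-constant affine `h` has a translate `t` with `h(· ⊕ t) = ¬h`, and the involution `y ↦ y ⊕ t` negates the signed sum).
The `e = 0` term of the outer sum is `2^n > 0`; if no `e ≠ 0` has `D_e q ≡ true` then no `e` at all does, so every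
term is `≥ 0` (constant-false or balanced derivative) and the outer sum is `> 0`, contradicting balancedness.  (No structure
theory of quadratic forms is needed.)  Everything is proved from Mathlib and the tree (`stub_derivDegree`,
`ar_affine_apply_bxor`, `fc_bool_xor_eq_true`, `signOf_xor`, `signOf_not`, the `bxor` algebra of `BuzetChailloux`); axioms
are the standard three.  Source: C. Carlet, *Boolean Functions for Cryptography and Coding Theory*, CUP 2021, §2.2
(derivatives, affine functions) and §5.2 (derivatives of quadratic functions).
-/

set_option linter.dupNamespace false -- D-0017: single-problem summit ⇒ `QuantumAdvantage.QuantumAdvantage` by design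

noncomputable section

namespace Summit.QuantumAdvantage.QuantumAdvantage.Theorems.CubicForrelation.NearExactIsExact

open Finset
open Literature.Computability.QuantumComplexity
open Literature.Computability.QuantumComplexity.BuzetChailloux (bxor zeroVec bxor_comm bxor_zeroVec bxorPerm
  bxorPerm_apply)
open Literature.Computability.QuantumComplexity.DerivativeWalsh (signOf_not)

variable {n : ℕ}

/-! ### Affine functions: constant or balanced -/

/-- **Affine dichotomy.** A Boolean function of algebraic degree `≤ 1` is either constant or balanced
(`Σ_y (−1)^{h(y)} = 0`): it is additive up to `h 0` (`ar_affine_apply_bxor`, from `stub_derivDegree`), so if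
`h t ≠ h 0` for some `t` then `h(y ⊕ t) = ¬h(y)` for every `y`, and reindexing the signed sum by the involution
`y ↦ y ⊕ t` negates it. [cite: Carlet2020, §2.2] -/
theorem qb_affine_dichotomy {h : (Fin n → Bool) → Bool} (hh : IsDegLeFun 1 h) :
    (∀ y, h y = h zeroVec) ∨ ∑ y, signOf (h y) = 0 := by
  by_cases hc : ∀ y, h y = h zeroVec
  · exact Or.inl hc
  right
  obtain ⟨t, ht⟩ := not_forall.1 hc
  have key : ∀ a c d : Bool, ¬ d = c → (a ^^ (c ^^ d)) = !a := by decide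
  have hflip : ∀ y, h (bxor y t) = !h y := fun y => by
    rw [ar_affine_apply_bxor stub_derivDegree hh y t]
    exact key _ _ _ ht
  have hneg : ∑ y, signOf (h y) = -∑ y, signOf (h y) :=
    calc ∑ y, signOf (h y) = ∑ y, signOf (h (bxorPerm t y)) :=
          (Equiv.sum_comp (bxorPerm t) (fun y => signOf (h y))).symm
      _ = ∑ y, -signOf (h y) := sum_congr rfl fun y _ => by
          rw [bxorPerm_apply, bxor_comm, hflip, signOf_not]
      _ = -∑ y, signOf (h y) := sum_neg_distrib _
  linarith

/-! ### The autocorrelation identity -/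

/-- Square of the bias as a sum of derivative biases: `(Σ_y (−1)^{q(y)})² = Σ_e Σ_y (−1)^{q(y) ⊕ q(y ⊕ e)}`
(multiply out and reindex the inner sum by `z = y ⊕ e`). [folklore] -/
theorem qb_sq_sum_signOf (q : (Fin n → Bool) → Bool) :
    (∑ y, signOf (q y)) ^ 2 = ∑ e, ∑ y, signOf (q y ^^ q (bxor y e)) := by
  calc (∑ y, signOf (q y)) ^ 2 = ∑ y, ∑ z, signOf (q y) * signOf (q z) := by rw [sq, sum_mul_sum]
    _ = ∑ y, ∑ e, signOf (q y ^^ q (bxor y e)) := by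
        refine sum_congr rfl fun y _ => ?_
        rw [← Equiv.sum_comp (bxorPerm y)]
        simp only [bxorPerm_apply, signOf_xor]
    _ = ∑ e, ∑ y, signOf (q y ^^ q (bxor y e)) := sum_comm

/-! ### The stub -/

/-- **A balanced quadratic has a complementing linear structure.**  If `q : 𝔽₂ⁿ → 𝔽₂` has degree `≤ 2` and
`Σ_y (−1)^{q(y)} = 0`, then `q(y ⊕ e) = ¬ q(y)` for some `e ≠ 0` and all `y`: otherwise no derivative
`D_e q = q ⊕ q(· ⊕ e)` (affine, `stub_derivDegree`) is identically `true` (for `e = 0` it is identically `false`), so by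
the affine dichotomy every inner sum of `qb_sq_sum_signOf` is `≥ 0` and the `e = 0` one is `2ⁿ > 0`, contradicting
`(Σ_y (−1)^{q(y)})² = 0`. [folklore; e.g. Carlet 2021 §5.2 (derivatives of quadratic functions)] -/
theorem stub_quadBalancedStructure :
    ∀ (n : ℕ) (q : (Fin n → Bool) → Bool), IsDegLeFun 2 q → ∑ y, signOf (q y) = 0 →
      ∃ e : Fin n → Bool, e ≠ zeroVec ∧ ∀ y, q (bxor y e) = !q y := by
  intro n q hq hbal
  by_contra hne
  -- no derivative of `q` is identically `true`
  have hnt : ∀ e : Fin n → Bool, ¬ ∀ y, (q y ^^ q (bxor y e)) = true := by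
    intro e hall
    by_cases he : e = zeroVec
    · have h1 := hall zeroVec
      rw [he, bxor_zeroVec, Bool.xor_self] at h1
      exact Bool.false_ne_true h1
    · exact hne ⟨e, he, fun y => fc_bool_xor_eq_true _ _ (hall y)⟩
  -- hence every derivative bias is `≥ 0`
  have hS : ∀ e : Fin n → Bool, 0 ≤ ∑ y, signOf (q y ^^ q (bxor y e)) := by
    intro e
    rcases qb_affine_dichotomy (stub_derivDegree n 1 q e hq) with hc | hb
    · have hc : ∀ y, (q y ^^ q (bxor y e)) = (q zeroVec ^^ q (bxor zeroVec e)) := hc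
      by_cases h0 : (q zeroVec ^^ q (bxor zeroVec e)) = true
      · exact absurd (fun y => (hc y).trans h0) (hnt e)
      · have h0' : (q zeroVec ^^ q (bxor zeroVec e)) = false := by simpa using h0
        exact sum_nonneg fun y _ => by rw [hc y, h0']; norm_num [signOf]
    · exact le_of_eq hb.symm
  -- and the `e = 0` one is `> 0`
  have h0 : 0 < ∑ y, signOf (q y ^^ q (bxor y (zeroVec : Fin n → Bool))) := by
    refine sum_pos (fun y _ => ?_) ⟨zeroVec, mem_univ _⟩
    rw [bxor_zeroVec, Bool.xor_self]
    norm_num [signOf]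
  have hpos : (0 : ℝ) < ∑ e, ∑ y, signOf (q y ^^ q (bxor y e)) :=
    sum_pos' (fun e _ => hS e) ⟨zeroVec, mem_univ _, h0⟩
  rw [← qb_sq_sum_signOf q, hbal] at hpos
  norm_num at hpos

end Summit.QuantumAdvantage.QuantumAdvantage.Theorems.CubicForrelation.NearExactIsExact
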